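import Literature.MathematicalPhysics.QuantumFieldTheory.Balaban1983to89.B13Lemma3Assembly
import Literature.MathematicalPhysics.QuantumFieldTheory.Balaban1983to89.B13Eq210Components
import Literature.MathematicalPhysics.QuantumFieldTheory.Balaban1983to89.B13Ineq232TreeLength

/-!
# `Balaban1983to89.B13Lemma3AssemblyWindow` — T. Bałaban, *Renormalization group approach to lattice gauge field
theories. II. Cluster expansions*, Commun. Math. Phys. **116** (1988) 1–22 [Balaban1988RG2Cluster], p. 18: the combined
geometric input (2.27) + (2.32) of the 𝐃-sum in the resummation proving Lemma 3 (`B13Lemma3Assembly.bound238With_of_226`,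
hypothesis `h2732`) DISCHARGED for the tree's concrete model of the localization domains — the window system
`TreeLengthCubeSystem.sys B` (face-connected families of unit cubes of a window `B ⊂ ℤ⁴`, d_k = `TreeLength.treeLen`)

statement-level skeleton of published theorems with citation tags; proofs where landed; nothing here is a claim about
the Yang–Mills mass gap

CITATION HEADER / WHAT IS REPRODUCED (unit `lit-balaban-r10` gen 5, B13 fold owner; SKELETON rows `B13.Eq2.27`,
`B13.Eq2.32`, `B13.Eq2.35` of `HOME/lit-balaban-r10/ROWS-B13.md`).  P. 18 [PDF 18], verbatim: *"Because ∪_{Y∈𝐃} Y = Y₀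
and Y₀ is a connected domain, hence the definition of d_k(Y) implies the inequality Σ_{Y∈𝐃}(d_k(Y) + 5) ≧ d_k(Y₀) + 5.
(2.27)"* … *"In general the set Z₀ is a union of connected components. Let us denote one of the components by Z₀. It
contains Y₀ = ∪_i Y_i. By a simple geometric argument we have Σ_i d_k(Y_i) + 4M⁻⁴|Z₀∖Y₀| ≧ d_k(Z₀). (2.32)"* and p. 17:
*"The set Y₀ is a union of its connected components, Y₀ = ∪_i Y_i, and this decomposition induces the decomposition of
the families 𝐃, 𝐃 = ∪_i 𝐃_i, 𝐃_i satisfy ∪_{Y∈𝐃_i} Y = Y_i."*  The assembly `B13Lemma3Assembly` consumes the two in the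
COMBINED form `d_k(Z₀) + 5 ≤ Σ_{Y∈𝐃}(d_k(Y) + 5) + c₃₂·|Z₀∖Y₀|` for every covering family 𝐃 of an arbitrary Y₀ ⊆ Z₀
(`B13Lemma3Assembly.combined_of_227_232` derives it from (2.27) per component and (2.32)); HERE that combined form is
PROVED for the window system at d = 4 with the kernel constant c₃₂ = 17 of `B13Ineq232TreeLength.ineq232_treeLen_four`
(print: 4 — refuted, `B13Ineq232Star.not_ineq232Printed_star_four`), from the tree's theorems: the connected components
`B13Eq210Components.compsF` of Y₀ (pairwise wall-separated, covering Y₀, each a localization domain), (2.27) per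
component `TreeLengthCubeSystem.ineq227_cells` (`TreeLength.ineq227_treeLen`), and (2.32)
`B13Ineq232TreeLength.ineq232_treeLen_four` on the datum `B13Ineq232.CompData` built from (Z₀, components of Y₀).
WHAT IS PROVED: `compData` (the (2.32)-datum of a face-connected Z₀ ⊇ Y₀ with the components of Y₀); `subset_compF_of_faceConnected`
(a connected family inside Y₀ lies inside ONE component — the p. 17 sentence); `h2732_window` (the hypothesis `h2732` of
`B13Lemma3Assembly.bound238With_of_226` for `S.Dk := TreeLengthCubeSystem.sys B`, `cubes := cellsOf B`, c₃₂ = 17).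
No new named fact (D-0026); nothing of print is asserted beyond what the cited theorems prove.

v1.1 (unit `lit-balaban-r10` gen 8; APPEND-ONLY, v1 declarations byte-identical): `h2732_window_general` — the same
combined (2.27) + (2.32) input in every dimension d with the kernel constant `c₃₂ = 1 + 4d` of
`B13Ineq232TreeLength.ineq232_treeLen` (d = 4: 17).
-/

namespace Literature.MathematicalPhysics.QuantumFieldTheory.Balaban1983to89.B13Lemma3AssemblyWindow

open Literature.MathematicalPhysics.QuantumFieldTheory.Balaban1983to89
open Literature.MathematicalPhysics.QuantumFieldTheory.Balaban1983to89.B14Components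
open Literature.MathematicalPhysics.QuantumFieldTheory.Balaban1983to89.B13Factor210
open Literature.MathematicalPhysics.QuantumFieldTheory.Balaban1983to89.B13ScaleTransfer (Pt Adj Linked FaceConnected)
open Literature.MathematicalPhysics.QuantumFieldTheory.Balaban1983to89.TreeLength (treeLen treeLen_nonneg)
open Literature.MathematicalPhysics.QuantumFieldTheory.Balaban1983to89.TreeLengthCubeSystem
  (IsDom Dom sys Cell cellsOf mem_cellsOf card_cellsOf cellsOf_inj ineq227_cells)
open Literature.MathematicalPhysics.QuantumFieldTheory.Balaban1983to89.B13Eq210Components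

noncomputable section

variable {d : ℕ}

/-! ## §1. The (2.32)-datum of a connected Z₀ and the components of Y₀ ⊆ Z₀ -/

/-- The datum of (2.32) p. 18 (*"one of the components … Z₀. It contains Y₀ = ∪_i Y_i"*) for a face-connected family Z₀
and ANY sub-family Y₀ ⊆ Z₀, the parts being the connected components `B13Eq210Components.compsF Y₀` (non-empty,
connected, pairwise disjoint and wall-free: `compsF_pairwise`). [cite: Balaban1988RG2Cluster, (2.32) p.18] -/
def compData (Z₀ Y₀ : Finset (Pt d)) (hZ : FaceConnected Z₀) (hY : Y₀ ⊆ Z₀) : B13Ineq232.CompData d where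
  Z₀ := Z₀
  parts := compsF Y₀
  hZ := hZ
  sub := fun P hP => by
    obtain ⟨a, -, rfl⟩ := mem_compsF.1 hP
    exact (compF_subset Y₀ a).trans hY
  ne := fun P hP => by
    obtain ⟨a, ha, rfl⟩ := mem_compsF.1 hP
    exact (isDom_compF (subset_refl Y₀) ha).2.1
  conn := fun P hP => by
    obtain ⟨a, ha, rfl⟩ := mem_compsF.1 hP
    exact (isDom_compF (subset_refl Y₀) ha).2.2
  disj := fun P hP Q hQ hPQ => by
    have hsep := compsF_pairwise Y₀ (Finset.mem_coe.2 hP) (Finset.mem_coe.2 hQ) hPQ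
    exact Finset.disjoint_left.2 fun x hxP hxQ => (hsep x (Finset.mem_coe.2 hxP) x (Finset.mem_coe.2 hxQ)).1 rfl
  sep := fun P hP Q hQ hPQ x hx y hy hadj => by
    have hsep := compsF_pairwise Y₀ (Finset.mem_coe.2 hP) (Finset.mem_coe.2 hQ) hPQ
    exact (hsep x (Finset.mem_coe.2 hx) y (Finset.mem_coe.2 hy)).2 (adj_iff_wallAdjacent.1 hadj)

/-- The parts of `compData` are the components of Y₀, its Y₀ is Y₀ (`biUnion_compsF`), its W is Z₀ ∖ Y₀. [cite: Balaban1988RG2Cluster, (2.32) p.18] -/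
theorem compData_W (Z₀ Y₀ : Finset (Pt d)) (hZ : FaceConnected Z₀) (hY : Y₀ ⊆ Z₀) :
    (compData Z₀ Y₀ hZ hY).W = Z₀ \ Y₀ := by
  classical
  unfold B13Ineq232.CompData.W B13Ineq232.CompData.Y₀
  show Z₀ \ (compsF Y₀).biUnion id = Z₀ \ Y₀
  rw [biUnion_compsF]

/-- P. 17: *"this decomposition induces the decomposition of the families 𝐃, 𝐃 = ∪_i 𝐃_i, 𝐃_i satisfy ∪_{Y∈𝐃_i} Y =
Y_i"* — its geometric content: a connected family Y inside Y₀ lies inside ONE connected component of Y₀, namely the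
component of any of its cubes (`B13Factor210.WallConnected.subset_wComp`). [cite: Balaban1988RG2Cluster, p.17 (resummation order)] -/
theorem subset_compF_of_faceConnected {Y Y₀ : Finset (Pt d)} (hYc : FaceConnected Y) (hYY₀ : Y ⊆ Y₀) {a : Pt d}
    (ha : a ∈ Y) : Y ⊆ compF Y₀ a := by
  have h : (↑Y : Set (Pt d)) ⊆ wComp (↑Y₀ : Set (Pt d)) a :=
    (faceConnected_iff_wallConnected.1 hYc).subset_wComp (Finset.coe_subset.2 hYY₀) (Finset.mem_coe.2 ha)
  rw [← coe_compF (hYY₀ ha)] at h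
  exact Finset.coe_subset.1 h

/-! ## §2. The combined (2.27) + (2.32) for the window system -/

/-- For K ⊆ B the underlying family of `cellsOf B K` is K. [folklore] -/
private theorem image_val_cellsOf {B K : Finset (Pt d)} (hKB : K ⊆ B) :
    (cellsOf B K).image Subtype.val = K := by
  ext x
  simp only [Finset.mem_image, mem_cellsOf]
  constructor
  · rintro ⟨c, hc, rfl⟩; exact hc
  · intro hx; exact ⟨⟨x, hKB hx⟩, hx, rfl⟩

/-- For Y₀ ⊆ cellsOf B Z (Z ⊆ B) the family of underlying cubes recovers Y₀. [folklore] -/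
private theorem cellsOf_image_val {B : Finset (Pt d)} (Y₀ : Finset (Cell B)) :
    cellsOf B (Y₀.image Subtype.val) = Y₀ := by
  ext c
  simp only [mem_cellsOf, Finset.mem_image]
  constructor
  · rintro ⟨c', hc', h⟩
    have : c' = c := Subtype.ext h
    rw [← this]; exact hc'
  · intro hc; exact ⟨c, hc, rfl⟩

/-- `cellsOf B` is monotone. [folklore] -/
private theorem cellsOf_mono {B K K' : Finset (Pt d)} (h : K ⊆ K') : cellsOf B K ⊆ cellsOf B K' :=
  fun _ hc => mem_cellsOf.2 (h (mem_cellsOf.1 hc))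

/-- `cellsOf B` respects set difference. [folklore] -/
private theorem cellsOf_sdiff (B K K' : Finset (Pt d)) : cellsOf B (K \ K') = cellsOf B K \ cellsOf B K' := by
  ext c
  simp only [mem_cellsOf, Finset.mem_sdiff]

/-- **The hypothesis `h2732` of `B13Lemma3Assembly.bound238With_of_226` for the window system** (d = 4,
`S.Dk := TreeLengthCubeSystem.sys B`, `cubes := cellsOf B`, c₃₂ = 17): for every localization domain Z₀ of the window
(a connected component of the set Z₀, p. 18), every Y₀ ⊆ Z₀ and every NON-EMPTY family 𝐃 of localization domains
whose cubes cover exactly Y₀ (`B13FamilySum.coveringFamilies`),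
`treeLen Z₀ + 5 ≤ Σ_{Y∈𝐃}(treeLen Y + 5) + 17·|Z₀∖Y₀|` — (2.27) for the components of Y₀ (`TreeLengthCubeSystem.ineq227_cells`)
combined with (2.32) in its kernel form (`B13Ineq232TreeLength.ineq232_treeLen_four`, constant 17 for the printed 4)
through `B13Lemma3Assembly.combined_of_227_232`. [cite: Balaban1988RG2Cluster, (2.27) and (2.32) p.18] -/
theorem h2732_window (B : Finset (Pt 4)) (Zc : Dom B) (Y₀ : Finset (Cell B)) (hY₀ : Y₀ ⊆ cellsOf B Zc.1)
    (D : Finset (Dom B))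
    (hD : D ∈ B13FamilySum.coveringFamilies (Finset.univ : Finset (Dom B)) (fun Y : Dom B => cellsOf B Y.1) Y₀)
    (hDne : D.Nonempty) :
    treeLen Zc.1 + 5 ≤ ∑ Y ∈ D, (treeLen Y.1 + 5) + 17 * ((cellsOf B Zc.1 \ Y₀).card : ℝ) := by
  classical
  -- the underlying families of cubes
  set Y₀' : Finset (Pt 4) := Y₀.image Subtype.val with hY₀'
  have hY₀'Z : Y₀' ⊆ Zc.1 := by
    intro x hx
    obtain ⟨c, hc, rfl⟩ := Finset.mem_image.1 hx
    exact mem_cellsOf.1 (hY₀ hc)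
  have hY₀'B : Y₀' ⊆ B := hY₀'Z.trans Zc.2.1
  have hcells : cellsOf B Y₀' = Y₀ := cellsOf_image_val Y₀
  -- Y₀ is non-empty since 𝐃 is
  obtain ⟨hDS, hU⟩ := B13FamilySum.mem_coveringFamilies.1 hD
  have hY₀ne : Y₀'.Nonempty := by
    obtain ⟨Y, hY⟩ := hDne
    obtain ⟨x, hx⟩ := Y.2.2.1
    have hc : (⟨x, Y.2.1 hx⟩ : Cell B) ∈ Y₀ := by
      rw [← hU]; exact Finset.mem_biUnion.2 ⟨Y, hY, mem_cellsOf.2 hx⟩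
    exact ⟨x, Finset.mem_image.2 ⟨_, hc, rfl⟩⟩
  -- the (2.32)-datum and the parts as families of cells
  set CD := compData Zc.1 Y₀' Zc.2.2.2 hY₀'Z with hCD
  set parts : Finset (Finset (Cell B)) := (compsF Y₀').image (cellsOf B) with hparts
  set dpart : Finset (Cell B) → ℝ := fun p => treeLen (p.image Subtype.val) with hdpart
  have hKB : ∀ K ∈ compsF Y₀', K ⊆ B := fun K hK => by
    obtain ⟨a, -, rfl⟩ := mem_compsF.1 hK
    exact (compF_subset Y₀' a).trans hY₀'B
  have hdpart_cells : ∀ K ∈ compsF Y₀', dpart (cellsOf B K) = treeLen K := fun K hK => by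
    simp only [hdpart, image_val_cellsOf (hKB K hK)]
  have hinj : ∀ K ∈ compsF Y₀', ∀ K' ∈ compsF Y₀', cellsOf B K = cellsOf B K' → K = K' :=
    fun K hK K' hK' h => cellsOf_inj (hKB K hK) (hKB K' hK') h
  refine B13Lemma3Assembly.combined_of_227_232 (Finset.univ : Finset (Dom B)) (fun Y : Dom B => cellsOf B Y.1)
    (sys B).dj Y₀ parts dpart (dZ := treeLen Zc.1) (c₃₂ := 17) (N' := ((cellsOf B Zc.1 \ Y₀).card : ℝ))
    (fun Y _ => ?_) (fun Y _ => treeLen_nonneg Y.1) ?_ ?_ ?_ ?_ ?_ ?_ D hD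
  · -- non-empty footprints
    obtain ⟨x, hx⟩ := Y.2.2.1
    exact ⟨⟨x, Y.2.1 hx⟩, mem_cellsOf.2 hx⟩
  · -- parts non-empty
    obtain ⟨a, ha⟩ := hY₀ne
    exact ⟨cellsOf B (compF Y₀' a), Finset.mem_image.2 ⟨_, mem_compsF.2 ⟨a, ha, rfl⟩, rfl⟩⟩
  · -- parts inside Y₀
    intro p hp
    obtain ⟨K, hK, rfl⟩ := Finset.mem_image.1 hp
    obtain ⟨a, -, rfl⟩ := mem_compsF.1 hK
    rw [← hcells]
    exact cellsOf_mono (compF_subset Y₀' a)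
  · -- parts pairwise disjoint
    intro p hp q hq hpq
    obtain ⟨K, hK, rfl⟩ := Finset.mem_image.1 hp
    obtain ⟨K', hK', rfl⟩ := Finset.mem_image.1 hq
    have hKK' : K ≠ K' := fun h => hpq (by rw [h])
    have hd := CD.disj K hK K' hK' hKK'
    exact Finset.disjoint_left.2 fun c hcK hcK' =>
      Finset.disjoint_left.1 hd (mem_cellsOf.1 hcK) (mem_cellsOf.1 hcK')
  · -- a connected member inside Y₀ lies inside one component
    intro Y _ hYY₀
    have hY' : Y.1 ⊆ Y₀' := fun x hx => by
      have hc : (⟨x, Y.2.1 hx⟩ : Cell B) ∈ Y₀ := hYY₀ (mem_cellsOf.2 hx)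
      exact Finset.mem_image.2 ⟨_, hc, rfl⟩
    obtain ⟨a, ha⟩ := Y.2.2.1
    refine ⟨cellsOf B (compF Y₀' a), Finset.mem_image.2 ⟨_, mem_compsF.2 ⟨a, hY' ha, rfl⟩, rfl⟩, ?_⟩
    exact cellsOf_mono (subset_compF_of_faceConnected Y.2.2.2 hY' ha)
  · -- (2.27) per component
    intro p hp
    obtain ⟨K, hK, rfl⟩ := Finset.mem_image.1 hp
    obtain ⟨a, ha, rfl⟩ := mem_compsF.1 hK
    have hdom : IsDom B (compF Y₀' a) := isDom_compF hY₀'B ha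
    rw [hdpart_cells _ hK]
    exact ineq227_cells B ⟨compF Y₀' a, hdom⟩
  · -- (2.32) with the kernel constant 17
    have h232 := B13Ineq232TreeLength.ineq232_treeLen_four CD (by
      obtain ⟨a, ha⟩ := hY₀ne
      exact ⟨compF Y₀' a, mem_compsF.2 ⟨a, ha, rfl⟩⟩)
    have hW : (CD.W.card : ℝ) = ((cellsOf B Zc.1 \ Y₀).card : ℝ) := by
      rw [hCD, compData_W, ← hcells, ← cellsOf_sdiff, card_cellsOf (Finset.sdiff_subset.trans Zc.2.1)]
    have hsum : ∑ P ∈ CD.parts, treeLen P = ∑ p ∈ parts, dpart p := by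
      rw [hparts, Finset.sum_image hinj]
      exact Finset.sum_congr rfl fun K hK => (hdpart_cells K hK).symm
    rw [hW, hsum] at h232
    exact h232


/-- **(v1.1) The combined (2.27) + (2.32) input IN EVERY DIMENSION d**, with the kernel constant `c₃₂ = 1 + 4d` of
`B13Ineq232TreeLength.ineq232_treeLen` (the (2.32)-substitute for the formalised tree length; print: 4, refuted in
every d ≥ 3, `B13Ineq232Star.not_ineq232Printed_star`): for the window system `TreeLengthCubeSystem.sys B`, `B ⊂ ℤᵈ`,
every localization domain `Z₀`, every `Y₀ ⊆ Z₀` and every covering family 𝐃 of `Y₀`,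
`d_k(Z₀) + 5 ≤ Σ_{Y∈𝐃}(d_k(Y) + 5) + (1 + 4d)·|Z₀∖Y₀|` — the hypothesis `h2732` of
`B13Lemma3Assembly.bound238With_of_226` at `c₃₂ = 1 + 4d` (at d = 4 this is `h2732_window`, constant 17).  Same proof as
`h2732_window`, the d = 4 theorem `ineq232_treeLen_four` replaced by `ineq232_treeLen`.
[cite: Balaban1988RG2Cluster, (2.27)/(2.32) p.18] -/
theorem h2732_window_general (B : Finset (Pt d)) (Zc : Dom B) (Y₀ : Finset (Cell B)) (hY₀ : Y₀ ⊆ cellsOf B Zc.1)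
    (D : Finset (Dom B))
    (hD : D ∈ B13FamilySum.coveringFamilies (Finset.univ : Finset (Dom B)) (fun Y : Dom B => cellsOf B Y.1) Y₀)
    (hDne : D.Nonempty) :
    treeLen Zc.1 + 5 ≤ ∑ Y ∈ D, (treeLen Y.1 + 5) + (1 + 4 * (d : ℝ)) * ((cellsOf B Zc.1 \ Y₀).card : ℝ) := by
  classical
  -- the underlying families of cubes
  set Y₀' : Finset (Pt d) := Y₀.image Subtype.val with hY₀'
  have hY₀'Z : Y₀' ⊆ Zc.1 := by
    intro x hx
    obtain ⟨c, hc, rfl⟩ := Finset.mem_image.1 hx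
    exact mem_cellsOf.1 (hY₀ hc)
  have hY₀'B : Y₀' ⊆ B := hY₀'Z.trans Zc.2.1
  have hcells : cellsOf B Y₀' = Y₀ := cellsOf_image_val Y₀
  -- Y₀ is non-empty since 𝐃 is
  obtain ⟨hDS, hU⟩ := B13FamilySum.mem_coveringFamilies.1 hD
  have hY₀ne : Y₀'.Nonempty := by
    obtain ⟨Y, hY⟩ := hDne
    obtain ⟨x, hx⟩ := Y.2.2.1
    have hc : (⟨x, Y.2.1 hx⟩ : Cell B) ∈ Y₀ := by
      rw [← hU]; exact Finset.mem_biUnion.2 ⟨Y, hY, mem_cellsOf.2 hx⟩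
    exact ⟨x, Finset.mem_image.2 ⟨_, hc, rfl⟩⟩
  -- the (2.32)-datum and the parts as families of cells
  set CD := compData Zc.1 Y₀' Zc.2.2.2 hY₀'Z with hCD
  set parts : Finset (Finset (Cell B)) := (compsF Y₀').image (cellsOf B) with hparts
  set dpart : Finset (Cell B) → ℝ := fun p => treeLen (p.image Subtype.val) with hdpart
  have hKB : ∀ K ∈ compsF Y₀', K ⊆ B := fun K hK => by
    obtain ⟨a, -, rfl⟩ := mem_compsF.1 hK
    exact (compF_subset Y₀' a).trans hY₀'B
  have hdpart_cells : ∀ K ∈ compsF Y₀', dpart (cellsOf B K) = treeLen K := fun K hK => by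
    simp only [hdpart, image_val_cellsOf (hKB K hK)]
  have hinj : ∀ K ∈ compsF Y₀', ∀ K' ∈ compsF Y₀', cellsOf B K = cellsOf B K' → K = K' :=
    fun K hK K' hK' h => cellsOf_inj (hKB K hK) (hKB K' hK') h
  refine B13Lemma3Assembly.combined_of_227_232 (Finset.univ : Finset (Dom B)) (fun Y : Dom B => cellsOf B Y.1)
    (sys B).dj Y₀ parts dpart (dZ := treeLen Zc.1) (c₃₂ := 1 + 4 * (d : ℝ)) (N' := ((cellsOf B Zc.1 \ Y₀).card : ℝ))
    (fun Y _ => ?_) (fun Y _ => treeLen_nonneg Y.1) ?_ ?_ ?_ ?_ ?_ ?_ D hD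
  · -- non-empty footprints
    obtain ⟨x, hx⟩ := Y.2.2.1
    exact ⟨⟨x, Y.2.1 hx⟩, mem_cellsOf.2 hx⟩
  · -- parts non-empty
    obtain ⟨a, ha⟩ := hY₀ne
    exact ⟨cellsOf B (compF Y₀' a), Finset.mem_image.2 ⟨_, mem_compsF.2 ⟨a, ha, rfl⟩, rfl⟩⟩
  · -- parts inside Y₀
    intro p hp
    obtain ⟨K, hK, rfl⟩ := Finset.mem_image.1 hp
    obtain ⟨a, -, rfl⟩ := mem_compsF.1 hK
    rw [← hcells]
    exact cellsOf_mono (compF_subset Y₀' a)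
  · -- parts pairwise disjoint
    intro p hp q hq hpq
    obtain ⟨K, hK, rfl⟩ := Finset.mem_image.1 hp
    obtain ⟨K', hK', rfl⟩ := Finset.mem_image.1 hq
    have hKK' : K ≠ K' := fun h => hpq (by rw [h])
    have hd := CD.disj K hK K' hK' hKK'
    exact Finset.disjoint_left.2 fun c hcK hcK' =>
      Finset.disjoint_left.1 hd (mem_cellsOf.1 hcK) (mem_cellsOf.1 hcK')
  · -- a connected member inside Y₀ lies inside one component
    intro Y _ hYY₀
    have hY' : Y.1 ⊆ Y₀' := fun x hx => by
      have hc : (⟨x, Y.2.1 hx⟩ : Cell B) ∈ Y₀ := hYY₀ (mem_cellsOf.2 hx)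
      exact Finset.mem_image.2 ⟨_, hc, rfl⟩
    obtain ⟨a, ha⟩ := Y.2.2.1
    refine ⟨cellsOf B (compF Y₀' a), Finset.mem_image.2 ⟨_, mem_compsF.2 ⟨a, hY' ha, rfl⟩, rfl⟩, ?_⟩
    exact cellsOf_mono (subset_compF_of_faceConnected Y.2.2.2 hY' ha)
  · -- (2.27) per component
    intro p hp
    obtain ⟨K, hK, rfl⟩ := Finset.mem_image.1 hp
    obtain ⟨a, ha, rfl⟩ := mem_compsF.1 hK
    have hdom : IsDom B (compF Y₀' a) := isDom_compF hY₀'B ha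
    rw [hdpart_cells _ hK]
    exact ineq227_cells B ⟨compF Y₀' a, hdom⟩
  · -- (2.32) with the kernel constant 1 + 4d
    have h232 := B13Ineq232TreeLength.ineq232_treeLen CD (by
      obtain ⟨a, ha⟩ := hY₀ne
      exact ⟨compF Y₀' a, mem_compsF.2 ⟨a, ha, rfl⟩⟩)
    have hW : (CD.W.card : ℝ) = ((cellsOf B Zc.1 \ Y₀).card : ℝ) := by
      rw [hCD, compData_W, ← hcells, ← cellsOf_sdiff, card_cellsOf (Finset.sdiff_subset.trans Zc.2.1)]
    have hsum : ∑ P ∈ CD.parts, treeLen P = ∑ p ∈ parts, dpart p := by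
      rw [hparts, Finset.sum_image hinj]
      exact Finset.sum_congr rfl fun K hK => (hdpart_cells K hK).symm
    rw [hW, hsum] at h232
    exact h232

end

end Literature.MathematicalPhysics.QuantumFieldTheory.Balaban1983to89.B13Lemma3AssemblyWindow
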